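import Literature.AlgebraicGeometry.ShimuraVarieties.KudlaRapoport2013.Sec3ComplexUniformization
import Mathlib.RingTheory.Localization.AsSubring
import Mathlib.RingTheory.Localization.Ideal
import Mathlib.RingTheory.DedekindDomain.Dvr
import Mathlib.RingTheory.DedekindDomain.PID
import Mathlib.RingTheory.DedekindDomain.Factorization
import Mathlib.LinearAlgebra.FreeModule.PID
import Mathlib.RingTheory.Localization.Module
import Literature.NumberTheory.QuadraticFields.HeegnerCondition
import HarnessLib

/-!
# Self-dual hermitian `O_k`-lattices: generators adapted to a level ideal `𝔫` (semilocal basis with unimodular Gram matrix)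

Kernel-lane INPUT file for the discharge of the CLOSED named fact ★ `KR2013_13_5_reduction` of the statement carpet
★ `Literature/AlgebraicGeometry/ShimuraVarieties/KudlaRapoport2013/Sec13LevelStructures.lean` ([KudlaRapoport2013, §13.2 after
Def. 13.5 (arXiv v2 p. 50)] «if `L` is a self-dual `O_k`-module, then `L/NL` is isomorphic to `(O_k/N O_k)ⁿ` with the standard form»).
THEOREMS ONLY (no definition, no named fact, no `sorry`, no instance, no notation); cell hodgecm-mathlib, seat B-typ01 (g33); net debt 0.

## What is proved (`exists_generators_mod_ideal`)

Let `k` be an imaginary-quadratic field with complex conjugation `σ`, `𝔫 ⊆ O_k` a non-zero proper ideal with `σ(𝔫) ⊆ 𝔫`, and `(J, L)` a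
hermitian lattice in coordinates (`V = kⁿ`, Gram matrix `J`, READING R0 of the §3 carpet) with `L` a full `O_k`-lattice which is SELF-DUAL
(`L = L^∨`, ★ `IsSelfDualFor`).  Then there are `e₁, …, e_n ∈ L`, linearly independent over `k`, such that
* (a) `L = Σ_i O_k e_i + 𝔫 L`;
* (b) `Σ_i a_i e_i ∈ 𝔫 L` with `a_i ∈ O_k` only if every `a_i ∈ 𝔫` (so the `ē_i` form an `O_k/𝔫`-basis of `L/𝔫L`);
* (c) the Gram matrix `G = ((e_j, e_i))_{ij}` has entries in `O_k` and `det G` is a unit modulo `𝔫`.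

## The argument (O'Meara §81–§82 over the semilocal ring at `𝔫`)

Let `S = {s ∈ O_k : s is a unit mod 𝔫}` and `O' = S⁻¹ O_k ⊆ k` (Mathlib `Localization.subalgebra.ofField`).  `O'` is a Dedekind domain
(`IsLocalization.isDedekindDomain`) whose primes correspond to the primes of `O_k` disjoint from `S` (`IsLocalization.orderIsoOfPrime`),
i.e. `⊥` and the finitely many primes containing `𝔫` (a maximal `𝔭 ⊉ 𝔫` has `𝔭 + 𝔫 = O_k`, so contains an element `≡ 1 (mod 𝔫)`);
hence `O'` is a PID (`IsPrincipalIdealRing.of_finite_primes`).  The module `M = O'·L` is finitely generated and torsion-free, hence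
free (`Module.basisOfFiniteTypeTorsionFree'`), on a basis which we rescale by units of `O'` (elements of `S`) INTO `L`; self-duality
localises (`M = {x : (x, M) ⊆ O'}`, clearing denominators with `IsLocalization.exist_integer_multiples_of_finset`), so the Gram matrix
`G` of the basis lies in `GL_n(O')` (its inverse expresses the dual basis) — this is the engine of ★ `Sec9DiffInertHolds.lean` (seat B-typ01
(g32)), generalised from `(O_k)_𝔭` to `S⁻¹O_k`.  Clauses (a), (b), (c) follow by clearing a denominator `s ∈ S` and using `t s ≡ 1 (mod 𝔫)`.

## References
* [KudlaRapoport2013] S. Kudla, M. Rapoport, *Special cycles on unitary Shimura varieties II: global theory*, J. reine angew. Math. 697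
  (2014) 91–157 = arXiv:0912.3758v2, §13.2 (p. 50).
* [Omeara1963] O. T. O'Meara, *Introduction to quadratic forms* (1963), §81D–§82F (lattices over principal ideal domains, unimodular
  lattices and dual bases).
-/

set_option autoImplicit false

noncomputable section

open NumberField IsDedekindDomain Module
open Literature.NumberTheory.Automorphic.Liu2021.AppendixC (conj)
open Literature.AlgebraicGeometry.ShimuraVarieties.KudlaRapoport2013.Sec2Defs (sigmaInt)
open Literature.AlgebraicGeometry.ShimuraVarieties.KudlaRapoport2013.Sec3ComplexUniformization
  (krForm IsFullLattice IsSelfDualFor)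
open scoped Matrix nonZeroDivisors Pointwise

namespace Literature.AlgebraicGeometry.ShimuraVarieties.KudlaRapoport2013.Sec13LevelStructures

variable (k : Type) [Field k] [NumberField k] [IsTotallyComplex k] [Algebra.IsQuadraticExtension ℚ k]

/-! ### `σ` on `k` and on `O_k` -/

/-- `σ(σ x) = x`. [folklore] -/
private theorem conj_conj' (x : k) : conj ℚ k (conj ℚ k x) = x := by
  letI : IsCMField k := IsCMField.ofCMExtension ℚ k
  exact IsCMField.complexConj_apply_apply (K := k) x

/-- `sigmaInt` is `σ` on `O_k`. [folklore] -/
private theorem coe_sigmaInt (a : 𝓞 k) : ((sigmaInt k a : 𝓞 k) : k) = conj ℚ k a := rfl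

/-! ### The hermitian pairing `(x, y) = σ(y)ᵀ J x` (★ `krForm`): sesquilinearity -/

section KrForm

variable {k}
variable {n : ℕ} (J : Matrix (Fin n) (Fin n) k)

/-- Additivity of `(x, y)` in `x`. [folklore] -/
private theorem krForm_add_left (x x' y : Fin n → k) :
    krForm (conj ℚ k : k →+* k) J (x + x') y = krForm (conj ℚ k : k →+* k) J x y + krForm (conj ℚ k : k →+* k) J x' y := by
  simp [krForm, Matrix.mulVec_add, dotProduct_add]

/-- `k`-linearity of `(x, y)` in `x`. [folklore] -/
private theorem krForm_smul_left (c : k) (x y : Fin n → k) :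
    krForm (conj ℚ k : k →+* k) J (c • x) y = c * krForm (conj ℚ k : k →+* k) J x y := by
  simp [krForm, Matrix.mulVec_smul, dotProduct_smul]

/-- `(0, y) = 0`. [folklore] -/
private theorem krForm_zero_left (y : Fin n → k) : krForm (conj ℚ k : k →+* k) J 0 y = 0 := by
  simp [krForm]

/-- Additivity of `(x, y)` in `y`. [folklore] -/
private theorem krForm_add_right (x y y' : Fin n → k) :
    krForm (conj ℚ k : k →+* k) J x (y + y') = krForm (conj ℚ k : k →+* k) J x y + krForm (conj ℚ k : k →+* k) J x y' := by
  have h : (⇑(conj ℚ k : k →+* k) ∘ (y + y')) = (⇑(conj ℚ k : k →+* k) ∘ y) + (⇑(conj ℚ k : k →+* k) ∘ y') := by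
    funext i; simp
  rw [krForm, krForm, krForm, h, add_dotProduct]

/-- `σ`-antilinearity of `(x, y)` in `y`. [folklore] -/
private theorem krForm_smul_right (c : k) (x y : Fin n → k) :
    krForm (conj ℚ k : k →+* k) J x (c • y) = conj ℚ k c * krForm (conj ℚ k : k →+* k) J x y := by
  have h : (⇑(conj ℚ k : k →+* k) ∘ (c • y)) = conj ℚ k c • (⇑(conj ℚ k : k →+* k) ∘ y) := by
    funext i; simp
  rw [krForm, krForm, h, smul_dotProduct, smul_eq_mul]

/-- `(x, 0) = 0`. [folklore] -/
private theorem krForm_zero_right (x : Fin n → k) : krForm (conj ℚ k : k →+* k) J x 0 = 0 := by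
  have h : (⇑(conj ℚ k : k →+* k) ∘ (0 : Fin n → k)) = 0 := by funext i; simp
  rw [krForm, h, zero_dotProduct]

/-- Finite sums in the first variable. [folklore] -/
private theorem krForm_sum_left {ι : Type*} (s : Finset ι) (x : ι → Fin n → k) (y : Fin n → k) :
    krForm (conj ℚ k : k →+* k) J (∑ i ∈ s, x i) y = ∑ i ∈ s, krForm (conj ℚ k : k →+* k) J (x i) y := by
  classical
  induction s using Finset.induction_on with
  | empty => simp [krForm_zero_left]
  | insert a s ha ih => rw [Finset.sum_insert ha, Finset.sum_insert ha, krForm_add_left, ih]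

/-- Finite sums in the second variable. [folklore] -/
private theorem krForm_sum_right {ι : Type*} (s : Finset ι) (x : Fin n → k) (y : ι → Fin n → k) :
    krForm (conj ℚ k : k →+* k) J x (∑ i ∈ s, y i) = ∑ i ∈ s, krForm (conj ℚ k : k →+* k) J x (y i) := by
  classical
  induction s using Finset.induction_on with
  | empty => simp [krForm_zero_right]
  | insert a s ha ih => rw [Finset.sum_insert ha, Finset.sum_insert ha, krForm_add_right, ih]

/-- `(e_j, e_i)` as a matrix product: the Gram matrix of a family `e` is `ᵗ(σ g) J g` for the matrix `g` with columns `e_i`. [folklore] -/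
private theorem krForm_eq_mul_apply (e : Fin n → Fin n → k) (i j : Fin n) :
    krForm (conj ℚ k : k →+* k) J (e j) (e i) =
      (((Matrix.of fun a l => e l a).map (conj ℚ k : k →+* k))ᵀ * J * Matrix.of fun a l => e l a) i j := by
  simp only [krForm, dotProduct, Matrix.mulVec, Function.comp_apply, Matrix.mul_apply, Matrix.transpose_apply,
    Matrix.map_apply, Matrix.of_apply, Finset.sum_mul, Finset.mul_sum]
  rw [Finset.sum_comm]
  refine Finset.sum_congr rfl fun a _ => Finset.sum_congr rfl fun b _ => ?_
  ring

end KrForm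

/-! ### The lattice `M = O'·L` over a `σ`-stable principal subring `O' ⊆ k` with denominators and integral multiples -/

section Localized

variable {k}
variable {n : ℕ} {J : Matrix (Fin n) (Fin n) k} {L : Submodule (𝓞 k) (Fin n → k)}
variable (O' : Subalgebra (𝓞 k) k)

omit [NumberField k] [IsTotallyComplex k] [Algebra.IsQuadraticExtension ℚ k] in
/-- `O_k ⊆ O'`, as a statement about the range of `O_k → k`. [folklore] -/
private theorem range_le (x : k) (hx : x ∈ (algebraMap (𝓞 k) k).range) : x ∈ O' := by
  obtain ⟨a, rfl⟩ := hx
  exact O'.algebraMap_mem a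

/-- The values of the pairing on `M = O'·F` lie in `O'` when `F ⊆ L`, `L` is integral (`(L, L) ⊆ O_k`) and `σ(O') ⊆ O'`. [folklore] -/
private theorem krForm_mem_of_mem_span (hσ : ∀ x ∈ O', conj ℚ k x ∈ O')
    (hLL : ∀ x ∈ L, ∀ y ∈ L, krForm (conj ℚ k : k →+* k) J x y ∈ (algebraMap (𝓞 k) k).range)
    {F : Set (Fin n → k)} (hF : F ⊆ L) {x y : Fin n → k}
    (hx : x ∈ Submodule.span O' F) (hy : y ∈ Submodule.span O' F) :
    krForm (conj ℚ k : k →+* k) J x y ∈ O' := by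
  induction hx, hy using Submodule.span_induction₂ with
  | mem_mem x y hx hy => exact range_le O' _ (hLL x (hF hx) y (hF hy))
  | zero_left y hy => rw [krForm_zero_left]; exact zero_mem _
  | zero_right x hx => rw [krForm_zero_right]; exact zero_mem _
  | add_left x y z hx hy hz h1 h2 => rw [krForm_add_left]; exact add_mem h1 h2
  | add_right x y z hx hy hz h1 h2 => rw [krForm_add_right]; exact add_mem h1 h2
  | smul_left r x y hx hy h => rw [Subalgebra.smul_def, krForm_smul_left]; exact mul_mem r.2 h
  | smul_right r x y hx hy h => rw [Subalgebra.smul_def, krForm_smul_right]; exact mul_mem (hσ _ r.2) h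

/-- **Self-duality localises**: if `L` is self-dual, `F ⊆ L` a finite generating set, and `O'` admits common denominators
(`hden`), then every `x ∈ kⁿ` with `(x, y) ∈ O'` for all `y ∈ F` lies in `M = O'·F`. [cite: Omeara1963, §82F] -/
private theorem mem_span_of_forall_krForm_mem
    (hden : ∀ T : Finset k, (∀ t ∈ T, t ∈ O') →
      ∃ s : 𝓞 k, (s : k) ≠ 0 ∧ ((s : k))⁻¹ ∈ O' ∧ ∀ t ∈ T, (s : k) * t ∈ (algebraMap (𝓞 k) k).range)
    (hLd : IsSelfDualFor (conj ℚ k : k →+* k) J L) {F : Finset (Fin n → k)}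
    (hFL : Submodule.span (𝓞 k) (F : Set (Fin n → k)) = L) {x : Fin n → k}
    (hx : ∀ y ∈ F, krForm (conj ℚ k : k →+* k) J x y ∈ O') :
    x ∈ Submodule.span O' (F : Set (Fin n → k)) := by
  classical
  obtain ⟨s, hs0, hsO, hs⟩ := hden (F.image fun y => krForm (conj ℚ k : k →+* k) J x y)
    (by intro t ht; obtain ⟨y, hy, rfl⟩ := Finset.mem_image.1 ht; exact hx y hy)
  -- `(s x, y) ∈ O_k` for all `y ∈ L`
  have hsx : ∀ y ∈ L, krForm (conj ℚ k : k →+* k) J ((s : k) • x) y ∈ (algebraMap (𝓞 k) k).range := by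
    intro y hy
    rw [← hFL] at hy
    induction hy using Submodule.span_induction with
    | mem y hy =>
        rw [krForm_smul_left]
        exact hs _ (Finset.mem_image_of_mem _ hy)
    | zero => rw [krForm_zero_right]; exact zero_mem _
    | add y z hy hz h1 h2 => rw [krForm_add_right]; exact add_mem h1 h2
    | smul a y hy h =>
        rw [show a • y = ((a : k)) • y from rfl, krForm_smul_right]
        exact mul_mem ⟨sigmaInt k a, rfl⟩ h
  have hsxL : (s : k) • x ∈ L := (hLd ((s : k) • x)).2 hsx
  have hmem : (s : k) • x ∈ Submodule.span O' (F : Set (Fin n → k)) := by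
    have h := Submodule.span_le_restrictScalars (𝓞 k) O' (F : Set (Fin n → k))
    rw [hFL] at h
    exact h hsxL
  have hx' : x = (⟨((s : k))⁻¹, hsO⟩ : O') • ((s : k) • x) := by
    rw [Subalgebra.smul_def, smul_smul]
    change x = (((s : k))⁻¹ * (s : k)) • x
    rw [inv_mul_cancel₀ hs0, one_smul]
  rw [hx']
  exact Submodule.smul_mem _ _ hmem

/-- **Over a principal `σ`-stable subring `O' ⊆ k` with denominators in which `O'·L` has integral multiples, a self-dual integral lattice
`L` contains an `O'`-basis `e₁, …, e_n` of `O'·L` (a `k`-basis of `kⁿ`) whose Gram matrix `G = ((e_j, e_i))` is UNIMODULAR over `O'`**: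
`G C = 1` with `C ∈ M_n(O')`. [cite: Omeara1963, §81:3, §82F and 82:13] -/
private theorem exists_basis_unimodular_gram [IsPrincipalIdealRing O'] (hσ : ∀ x ∈ O', conj ℚ k x ∈ O')
    (hden : ∀ T : Finset k, (∀ t ∈ T, t ∈ O') →
      ∃ s : 𝓞 k, (s : k) ≠ 0 ∧ ((s : k))⁻¹ ∈ O' ∧ ∀ t ∈ T, (s : k) * t ∈ (algebraMap (𝓞 k) k).range)
    (hint : ∀ x ∈ Submodule.span O' (L : Set (Fin n → k)),
      ∃ s : 𝓞 k, (s : k) ≠ 0 ∧ ((s : k))⁻¹ ∈ O' ∧ (s : k) • x ∈ L)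
    (hL : IsFullLattice L) (hLd : IsSelfDualFor (conj ℚ k : k →+* k) J L) (hJ0 : J.det ≠ 0) :
    ∃ e : Fin n → (Fin n → k), (∀ i, e i ∈ L) ∧ LinearIndependent k e ∧
      (∀ x ∈ L, ∃ c : Fin n → k, (∀ i, c i ∈ O') ∧ x = ∑ i, c i • e i) ∧
      ∃ C : Matrix (Fin n) (Fin n) k, (∀ i j, C i j ∈ O') ∧
        (Matrix.of fun i j => krForm (conj ℚ k : k →+* k) J (e j) (e i)) * C = 1 := by
  classical
  obtain ⟨F, hFL⟩ := hL.1
  have hFsub : (F : Set (Fin n → k)) ⊆ L := hFL ▸ Submodule.subset_span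
  have hLL : ∀ x ∈ L, ∀ y ∈ L, krForm (conj ℚ k : k →+* k) J x y ∈ (algebraMap (𝓞 k) k).range :=
    fun x hx y hy => (hLd x).1 hx y hy
  set M : Submodule O' (Fin n → k) := Submodule.span O' (F : Set (Fin n → k)) with hM
  have hML : M ≤ Submodule.span O' (L : Set (Fin n → k)) := Submodule.span_mono hFsub
  haveI : Module.Finite O' M := Module.Finite.span_of_finite O' F.finite_toSet
  haveI : Module.IsTorsionFree O' (Fin n → k) := Module.IsTorsionFree.of_smul_eq_zero fun c v h => by
    rw [Subalgebra.smul_def] at h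
    rcases smul_eq_zero.1 h with h1 | h1
    · exact Or.inl (by exact_mod_cast h1)
    · exact Or.inr h1
  obtain ⟨m, b₀⟩ := Module.basisOfFiniteTypeTorsionFree' (R := O') (M := M)
  -- rescale the basis into `L` by units of `O'`
  choose s hs0 hsO hsL using fun i => hint (b₀ i : Fin n → k) (hML (b₀ i).2)
  let u : Fin m → O'ˣ := fun i =>
    ⟨⟨(s i : k), O'.algebraMap_mem (s i)⟩, ⟨((s i : k))⁻¹, hsO i⟩, Subtype.ext (mul_inv_cancel₀ (hs0 i)),
      Subtype.ext (inv_mul_cancel₀ (hs0 i))⟩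
  let b : Basis (Fin m) O' M := b₀.unitsSMul u
  have hb : ∀ i, (b i : Fin n → k) = (s i : k) • (b₀ i : Fin n → k) := by
    intro i
    change ((b₀.unitsSMul u i : M) : Fin n → k) = _
    rw [Basis.unitsSMul_apply]
    rfl
  set e : Fin m → (Fin n → k) := fun i => (b i : Fin n → k) with he
  have heL : ∀ i, e i ∈ L := fun i => by rw [he]; dsimp only; rw [hb]; exact hsL i
  have hli : LinearIndependent k e := by
    have h1 : LinearIndependent O' e := b.linearIndependent.map' M.subtype (Submodule.ker_subtype M)
    exact (LinearIndependent.iff_fractionRing O' k).1 h1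
  have hmemM : ∀ x ∈ L, x ∈ M := fun x hx => by
    have h := Submodule.span_le_restrictScalars (𝓞 k) O' (F : Set (Fin n → k))
    rw [hFL] at h
    exact h hx
  have hrepr : ∀ (y : Fin n → k) (hy : y ∈ M), y = ∑ i, ((b.repr ⟨y, hy⟩ i : O') : k) • e i := by
    intro y hy
    have h2 := congrArg (fun z : M => (z : Fin n → k)) (b.sum_repr ⟨y, hy⟩)
    simp only [AddSubmonoidClass.coe_finsetSum, SetLike.val_smul, Subalgebra.smul_def] at h2
    exact h2.symm
  have hsp : ⊤ ≤ Submodule.span k (Set.range e) := by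
    rw [← hL.2]
    refine Submodule.span_le.2 fun x hx => ?_
    rw [hrepr x (hmemM x hx)]
    exact Submodule.sum_mem _ fun i _ => Submodule.smul_mem _ _ (Submodule.subset_span ⟨i, rfl⟩)
  let E : Basis (Fin m) k (Fin n → k) := Basis.mk hli hsp
  have hmn : m = n := by
    have h := Module.finrank_eq_card_basis E
    simpa using h.symm
  subst hmn
  -- the matrices
  set g : Matrix (Fin m) (Fin m) k := Matrix.of fun a l => e l a with hg
  set G : Matrix (Fin m) (Fin m) k := (g.map (conj ℚ k : k →+* k))ᵀ * J * g with hGdef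
  have hG : ∀ i j, G i j = krForm (conj ℚ k : k →+* k) J (e j) (e i) := fun i j =>
    (krForm_eq_mul_apply J e i j).symm
  have hGof : (Matrix.of fun i j => krForm (conj ℚ k : k →+* k) J (e j) (e i)) = G := by
    ext i j
    rw [Matrix.of_apply, hG]
  have hgE : g = (Pi.basisFun k (Fin m)).toMatrix E := by
    ext a l
    rw [Basis.toMatrix_apply, Pi.basisFun_repr, Basis.coe_mk, hg, Matrix.of_apply]
  have hgdet : g.det ≠ 0 := by
    have h1 := (Pi.basisFun k (Fin m)).toMatrix_mul_toMatrix_flip E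
    rw [← hgE] at h1
    intro h0
    have h2 := congrArg Matrix.det h1
    rw [Matrix.det_mul, h0, zero_mul, Matrix.det_one] at h2
    exact zero_ne_one h2
  have hGdet : G.det ≠ 0 := by
    rw [hGdef, Matrix.det_mul, Matrix.det_mul, Matrix.det_transpose, ← RingHom.mapMatrix_apply, ← RingHom.map_det]
    exact mul_ne_zero (mul_ne_zero ((map_ne_zero _).2 hgdet) hJ0) hgdet
  set C : Matrix (Fin m) (Fin m) k := G⁻¹ with hC
  have hGC : G * C = 1 := Matrix.mul_nonsing_inv G (isUnit_iff_ne_zero.2 hGdet)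
  -- the dual basis lies in `M`, so `C` has entries in `O'`
  have hCmem : ∀ j l, C j l ∈ O' := by
    intro j l
    set f : Fin m → k := ∑ j', C j' l • e j' with hf
    have hfe : ∀ i, krForm (conj ℚ k : k →+* k) J f (e i) = if i = l then 1 else 0 := by
      intro i
      have h1 := congrFun (congrFun hGC i) l
      rw [Matrix.mul_apply, Matrix.one_apply] at h1
      rw [hf, krForm_sum_left, ← h1]
      refine Finset.sum_congr rfl fun j' _ => ?_
      rw [krForm_smul_left, ← hG, mul_comm]
    have hfM : f ∈ M := by
      refine mem_span_of_forall_krForm_mem O' hden hLd hFL fun y hy => ?_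
      rw [hrepr y (hmemM y (hFsub hy)), krForm_sum_right]
      refine Subalgebra.sum_mem _ fun i _ => ?_
      rw [krForm_smul_right, hfe]
      refine mul_mem (hσ _ (b.repr _ i).2) ?_
      split_ifs
      · exact one_mem _
      · exact zero_mem _
    have h1 : (E.repr f : Fin m → k) = fun j' => C j' l := by
      have h := E.repr_sum_self (fun j' => C j' l)
      have hsum : (∑ i, (fun j' => C j' l) i • E i) = f := by
        rw [hf]
        exact Finset.sum_congr rfl fun i _ => by rw [Basis.coe_mk]
      rw [hsum] at h
      exact h
    have h2 : (E.repr f : Fin m → k) = fun j' => ((b.repr ⟨f, hfM⟩ j' : O') : k) := by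
      have h := E.repr_sum_self (fun j' => ((b.repr ⟨f, hfM⟩ j' : O') : k))
      have hsum : (∑ i, (fun j' => ((b.repr ⟨f, hfM⟩ j' : O') : k)) i • E i) = f := by
        calc (∑ i, (fun j' => ((b.repr ⟨f, hfM⟩ j' : O') : k)) i • E i)
            = ∑ i, ((b.repr ⟨f, hfM⟩ i : O') : k) • e i :=
              Finset.sum_congr rfl fun i _ => by rw [Basis.coe_mk]
          _ = f := (hrepr f hfM).symm
      rw [hsum] at h
      exact h
    have h3 : C j l = ((b.repr ⟨f, hfM⟩ j : O') : k) := by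
      have h := congrFun (h1.symm.trans h2) j
      simpa using h
    rw [h3]
    exact (b.repr ⟨f, hfM⟩ j).2
  refine ⟨e, heL, hli, fun x hx => ⟨fun i => ((b.repr ⟨x, hmemM x hx⟩ i : O') : k), fun i => (b.repr _ i).2,
    hrepr x (hmemM x hx)⟩, C, hCmem, ?_⟩
  rw [hGof, hGC]

end Localized

/-! ### The semilocal ring `O' = S⁻¹ O_k`, `S` = units modulo `𝔫` -/

section Semilocal

variable {k}

omit [IsTotallyComplex k] [Algebra.IsQuadraticExtension ℚ k] in
/-- Membership in Mathlib's `Localization.subalgebra.ofField`: `x = a/s` with `s ∈ S`. [folklore] -/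
private theorem mem_ofField_iff {S : Submonoid (𝓞 k)} (hS : S ≤ (𝓞 k)⁰) (x : k) :
    x ∈ Localization.subalgebra.ofField k S hS ↔ ∃ (a s : 𝓞 k) (_ : s ∈ S), x = (a : k) * ((s : k))⁻¹ := by
  rw [← SetLike.mem_coe, Localization.subalgebra.ofField, Subalgebra.coe_copy]
  rfl

variable (𝔫 : Ideal (𝓞 k))

omit [NumberField k] [IsTotallyComplex k] [Algebra.IsQuadraticExtension ℚ k] in
/-- `s` is a unit modulo `𝔫` iff `s t ≡ 1 (mod 𝔫)` for some `t`. [folklore] -/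
private theorem isUnit_mk_iff (s : 𝓞 k) : IsUnit (Ideal.Quotient.mk 𝔫 s) ↔ ∃ t : 𝓞 k, s * t - 1 ∈ 𝔫 := by
  constructor
  · intro h
    obtain ⟨y, hy⟩ := isUnit_iff_exists_inv.1 h
    obtain ⟨t, rfl⟩ := Ideal.Quotient.mk_surjective y
    refine ⟨t, ?_⟩
    rw [← Ideal.Quotient.eq, map_mul, map_one]
    exact hy
  · rintro ⟨t, ht⟩
    refine isUnit_iff_exists_inv.2 ⟨Ideal.Quotient.mk 𝔫 t, ?_⟩
    rw [← map_mul, ← map_one (Ideal.Quotient.mk 𝔫), Ideal.Quotient.eq]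
    exact ht

omit [NumberField k] [IsTotallyComplex k] [Algebra.IsQuadraticExtension ℚ k] in
/-- For a proper ideal `𝔫`, units modulo `𝔫` are non-zero (indeed non-zero-divisors of the domain `O_k`). [folklore] -/
private theorem unitsMod_le_nonZeroDivisors (h𝔫1 : 𝔫 ≠ ⊤) :
    (IsUnit.submonoid (𝓞 k ⧸ 𝔫)).comap (Ideal.Quotient.mk 𝔫 : 𝓞 k →* 𝓞 k ⧸ 𝔫) ≤ (𝓞 k)⁰ := by
  intro s hs
  rw [Submonoid.mem_comap, IsUnit.mem_submonoid_iff] at hs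
  refine mem_nonZeroDivisors_of_ne_zero ?_
  rintro rfl
  apply h𝔫1
  obtain ⟨t, ht⟩ := (isUnit_mk_iff 𝔫 0).1 hs
  rw [zero_mul, zero_sub] at ht
  exact (Ideal.eq_top_iff_one 𝔫).2 (by simpa using 𝔫.neg_mem ht)

omit [IsTotallyComplex k] [Algebra.IsQuadraticExtension ℚ k] in
/-- **The primes of `O_k` disjoint from `S` (units mod `𝔫`) are `⊥` and primes containing `𝔫`**: a maximal `𝔭 ⊉ 𝔫` gives
`𝔭 + 𝔫 = O_k`, hence an element of `𝔭` congruent to `1` modulo `𝔫`. [folklore] -/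
private theorem le_of_disjoint_unitsMod {𝔭 : Ideal (𝓞 k)} (h𝔭 : 𝔭.IsPrime)
    (hdisj : Disjoint (((IsUnit.submonoid (𝓞 k ⧸ 𝔫)).comap (Ideal.Quotient.mk 𝔫 : 𝓞 k →* 𝓞 k ⧸ 𝔫) :
      Submonoid (𝓞 k)) : Set (𝓞 k)) 𝔭) (h𝔭0 : 𝔭 ≠ ⊥) : 𝔫 ≤ 𝔭 := by
  have hmax : 𝔭.IsMaximal := h𝔭.isMaximal h𝔭0
  by_contra hle
  have hlt : 𝔭 < 𝔭 ⊔ 𝔫 := lt_of_le_of_ne le_sup_left fun h => hle (h ▸ le_sup_right)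
  have htop : 𝔭 ⊔ 𝔫 = ⊤ := hmax.out.2 _ hlt
  obtain ⟨a, ha, b, hb, hab⟩ := Submodule.mem_sup.1 ((Ideal.eq_top_iff_one _).1 htop)
  have haS : a ∈ (((IsUnit.submonoid (𝓞 k ⧸ 𝔫)).comap (Ideal.Quotient.mk 𝔫 : 𝓞 k →* 𝓞 k ⧸ 𝔫) :
      Submonoid (𝓞 k)) : Set (𝓞 k)) := by
    rw [SetLike.mem_coe, Submonoid.mem_comap, IsUnit.mem_submonoid_iff]
    refine (isUnit_mk_iff 𝔫 a).2 ⟨1, ?_⟩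
    have h : a * 1 - 1 = -b := by linear_combination hab
    rw [h]
    exact 𝔫.neg_mem hb
  exact Set.disjoint_left.1 hdisj haS ha

omit [IsTotallyComplex k] [Algebra.IsQuadraticExtension ℚ k] in
/-- **`O' = S⁻¹O_k` is a principal ideal domain** (`𝔫 ≠ ⊥` proper): a Dedekind domain (localisation of `O_k`) with finitely many primes
(`⊥` and the finitely many primes containing `𝔫`); a Dedekind domain with finitely many primes is principal. [folklore] -/
private theorem isPrincipalIdealRing_ofField (h𝔫0 : 𝔫 ≠ ⊥) (h𝔫1 : 𝔫 ≠ ⊤) :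
    IsPrincipalIdealRing (Localization.subalgebra.ofField k
      ((IsUnit.submonoid (𝓞 k ⧸ 𝔫)).comap (Ideal.Quotient.mk 𝔫 : 𝓞 k →* 𝓞 k ⧸ 𝔫))
      (unitsMod_le_nonZeroDivisors 𝔫 h𝔫1)) := by
  set S : Submonoid (𝓞 k) := (IsUnit.submonoid (𝓞 k ⧸ 𝔫)).comap (Ideal.Quotient.mk 𝔫 : 𝓞 k →* 𝓞 k ⧸ 𝔫) with hSdef
  have hS : S ≤ (𝓞 k)⁰ := unitsMod_le_nonZeroDivisors 𝔫 h𝔫1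
  set O' : Subalgebra (𝓞 k) k := Localization.subalgebra.ofField k S hS with hO'
  haveI : IsLocalization S O' := Localization.subalgebra.isLocalization_ofField k S hS
  haveI : IsDedekindDomain O' := IsLocalization.isDedekindDomain (𝓞 k) hS O'
  -- the primes of `O_k` disjoint from `S` are finite in number
  have hfinK : {p : Ideal (𝓞 k) | p.IsPrime ∧ Disjoint (S : Set (𝓞 k)) p}.Finite := by
    have h1 : {v : HeightOneSpectrum (𝓞 k) | v.asIdeal ∣ 𝔫}.Finite := Ideal.finite_factors h𝔫0
    refine ((h1.image fun v : HeightOneSpectrum (𝓞 k) => v.asIdeal).union (Set.finite_singleton ⊥)).subset ?_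
    rintro p ⟨hp, hdisj⟩
    by_cases hp0 : p = ⊥
    · exact Or.inr hp0
    · exact Or.inl ⟨⟨p, hp, hp0⟩, Ideal.dvd_iff_le.2 (le_of_disjoint_unitsMod 𝔫 hp hdisj hp0), rfl⟩
  haveI : Finite {p : Ideal (𝓞 k) // p.IsPrime ∧ Disjoint (S : Set (𝓞 k)) p} := hfinK.to_subtype
  have hfin : Finite {p : Ideal O' // p.IsPrime} :=
    Finite.of_equiv _ (IsLocalization.orderIsoOfPrime S O').toEquiv.symm
  exact IsPrincipalIdealRing.of_finite_primes (Set.finite_coe_iff.mp hfin)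

end Semilocal

/-! ### The theorem: generators of a self-dual lattice adapted to `𝔫` -/

variable {k}

omit [IsTotallyComplex k] [Algebra.IsQuadraticExtension ℚ k] in
/-- A full `O_k`-lattice `L ⊆ kⁿ` has bounded denominators in each coordinate: some non-zero `d ∈ O_k` has `d · y_i ∈ O_k` for all `y ∈ L`
and all `i`. [folklore] -/
private theorem exists_denominator_coord {n : ℕ} {L : Submodule (𝓞 k) (Fin n → k)} (hL : IsFullLattice L) :
    ∃ d : 𝓞 k, (d : k) ≠ 0 ∧ ∀ y ∈ L, ∀ i, (d : k) * y i ∈ (algebraMap (𝓞 k) k).range := by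
  classical
  obtain ⟨F, hFL⟩ := hL.1
  obtain ⟨b, hb⟩ := IsLocalization.exist_integer_multiples_of_finset (𝓞 k)⁰
    (F.biUnion fun f => Finset.univ.image fun i => f i)
  have hb0 : ((b : 𝓞 k) : k) ≠ 0 := by
    have h := nonZeroDivisors.ne_zero b.2
    intro h0; apply h; exact_mod_cast h0
  refine ⟨b, hb0, fun y hy i => ?_⟩
  rw [← hFL] at hy
  induction hy using Submodule.span_induction generalizing i with
  | mem y hy =>
      obtain ⟨c, hc⟩ := hb (y i) (Finset.mem_biUnion.2 ⟨y, hy, Finset.mem_image.2 ⟨i, Finset.mem_univ _, rfl⟩⟩)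
      refine ⟨c, ?_⟩
      have h := hc
      simp only [Algebra.smul_def] at h
      exact h
  | zero => simp
  | add y z _ _ h1 h2 =>
      rw [Pi.add_apply, mul_add]
      exact add_mem (h1 i) (h2 i)
  | smul a y _ h =>
      rw [show (a • y) i = (a : k) * y i from rfl, mul_left_comm]
      exact mul_mem ⟨a, rfl⟩ (h i)

omit [IsTotallyComplex k] [Algebra.IsQuadraticExtension ℚ k] in
/-- `1/2 ∉ O_k`: an integer which is a unit in `O_k` is `±1` (norm), and `2` is not. [folklore] -/
private theorem inv_two_notMem_range : ((2 : k))⁻¹ ∉ (algebraMap (𝓞 k) k).range := by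
  rintro ⟨a, ha⟩
  have ha' : (a : k) = ((2 : k))⁻¹ := ha
  have h2 : IsUnit ((2 : ℤ) : 𝓞 k) := by
    refine isUnit_iff_exists_inv.2 ⟨a, ?_⟩
    have h : (((2 : ℤ) : 𝓞 k) * a : k) = ((1 : 𝓞 k) : k) := by
      push_cast
      rw [ha']
      exact mul_inv_cancel₀ two_ne_zero
    exact_mod_cast h
  have h := Literature.NumberTheory.QuadraticFields.Quadratic.isUnit_of_isUnit_intCast (K := k) h2
  have : ((2 : ℤ)).natAbs = 1 := Int.natAbs_of_isUnit h
  omega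

/-- **A self-dual lattice lives on a non-degenerate hermitian space**: if `det J = 0` then some `x ≠ 0` has `J x = 0`, so `(c x, L) = 0 ⊆ O_k`
and `c x ∈ L^∨ = L` for every `c ∈ k`, contradicting bounded denominators (`1/2 ∉ O_k`) — O'Meara: «an `𝔞`-modular lattice is regular»,
unimodular `⟺ L^# = L`. [cite: Omeara1963, §82G and 82:14b] -/
theorem SemilocalBasis.det_ne_zero_of_isSelfDualFor {n : ℕ} {J : Matrix (Fin n) (Fin n) k}
    {L : Submodule (𝓞 k) (Fin n → k)} (hL : IsFullLattice L) (hLd : IsSelfDualFor (conj ℚ k : k →+* k) J L) :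
    J.det ≠ 0 := by
  classical
  intro hdet
  obtain ⟨x, hx0, hJx⟩ := Matrix.exists_mulVec_eq_zero_iff.2 hdet
  have hcx : ∀ c : k, c • x ∈ L := fun c => (hLd (c • x)).2 fun y _ => ⟨0, by
    rw [map_zero, krForm, Matrix.mulVec_smul, hJx, smul_zero, dotProduct_zero]⟩
  obtain ⟨i, hi⟩ : ∃ i, x i ≠ 0 := by
    by_contra h
    push Not at h
    exact hx0 (funext h)
  obtain ⟨d, hd0, hd⟩ := exists_denominator_coord hL
  have h := hd _ (hcx (((2 : k))⁻¹ * ((d : k))⁻¹ * (x i)⁻¹)) i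
  rw [Pi.smul_apply, smul_eq_mul] at h
  have hcalc : (d : k) * (((2 : k))⁻¹ * ((d : k))⁻¹ * (x i)⁻¹ * x i) = ((2 : k))⁻¹ := by
    field_simp
  rw [hcalc] at h
  exact inv_two_notMem_range h

/-- **Generators of a self-dual hermitian `O_k`-lattice adapted to a level ideal** [KR2013 §13.2 after Def. 13.5, the lattice input to «`L/NL ≅
(O_k/N O_k)ⁿ`»].  For `𝔫 ⊆ O_k` a non-zero proper ideal with `σ(𝔫) ⊆ 𝔫` and `(J, L)` a full self-dual hermitian lattice in `kⁿ`, there are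
`e₁, …, e_n ∈ L`, linearly independent over `k`, with (a) `Σ O_k e_i + 𝔫L = L`, (b) `Σ a_i e_i ∈ 𝔫L ⇒ a_i ∈ 𝔫`, and (c) an integral Gram matrix
`G`, `G_{ij} = (e_j, e_i)`, whose determinant is a unit modulo `𝔫` — the reduction of a unimodular `O'`-basis of `O'·L`, `O' = S⁻¹O_k` the
(principal) semilocal ring at `𝔫`. [cite: KudlaRapoport2013, §13.2 (arXiv v2 p. 50)] [cite: Omeara1963, §81:3, §82F and 82:13–82:14b] -/
theorem SemilocalBasis.exists_generators_mod_ideal {n : ℕ} {J : Matrix (Fin n) (Fin n) k} {L : Submodule (𝓞 k) (Fin n → k)}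
    (𝔫 : Ideal (𝓞 k)) (h𝔫0 : 𝔫 ≠ ⊥) (h𝔫1 : 𝔫 ≠ ⊤) (hσ𝔫 : ∀ x ∈ 𝔫, sigmaInt k x ∈ 𝔫)
    (hL : IsFullLattice L) (hLd : IsSelfDualFor (conj ℚ k : k →+* k) J L) :
    ∃ (e : Fin n → (Fin n → k)) (G : Matrix (Fin n) (Fin n) (𝓞 k)), (∀ i, e i ∈ L) ∧ LinearIndependent k e ∧
      Submodule.span (𝓞 k) (Set.range e) ⊔ 𝔫 • L = L ∧
      (∀ a : Fin n → 𝓞 k, (∑ i, (a i : k) • e i) ∈ 𝔫 • L → ∀ i, a i ∈ 𝔫) ∧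
      (∀ i j, (G i j : k) = krForm (conj ℚ k : k →+* k) J (e j) (e i)) ∧ IsUnit (Ideal.Quotient.mk 𝔫 G.det) := by
  classical
  -- the semilocal ring `O'`
  set S : Submonoid (𝓞 k) := (IsUnit.submonoid (𝓞 k ⧸ 𝔫)).comap (Ideal.Quotient.mk 𝔫 : 𝓞 k →* 𝓞 k ⧸ 𝔫) with hSdef
  have hmemS : ∀ s : 𝓞 k, s ∈ S ↔ ∃ t : 𝓞 k, s * t - 1 ∈ 𝔫 := fun s => by
    rw [hSdef, Submonoid.mem_comap, IsUnit.mem_submonoid_iff]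
    exact isUnit_mk_iff 𝔫 s
  have hS : S ≤ (𝓞 k)⁰ := unitsMod_le_nonZeroDivisors 𝔫 h𝔫1
  have hS0 : ∀ s ∈ S, ((s : 𝓞 k) : k) ≠ 0 := fun s hs h0 =>
    nonZeroDivisors.ne_zero (hS hs) (by exact_mod_cast h0)
  set O' : Subalgebra (𝓞 k) k := Localization.subalgebra.ofField k S hS with hO'
  haveI : IsLocalization S O' := Localization.subalgebra.isLocalization_ofField k S hS
  haveI : IsPrincipalIdealRing O' := isPrincipalIdealRing_ofField 𝔫 h𝔫0 h𝔫1
  have hinvS : ∀ s ∈ S, (((s : 𝓞 k) : k))⁻¹ ∈ O' := fun s hs => (mem_ofField_iff hS _).2 ⟨1, s, hs, by simp⟩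
  -- `S` is `σ`-stable, hence so is `O'`
  have hσS : ∀ s ∈ S, sigmaInt k s ∈ S := by
    intro s hs
    obtain ⟨t, ht⟩ := (hmemS s).1 hs
    refine (hmemS _).2 ⟨sigmaInt k t, ?_⟩
    have h := hσ𝔫 _ ht
    rwa [map_sub, map_mul, map_one] at h
  have hσ : ∀ x ∈ O', conj ℚ k x ∈ O' := by
    intro x hx
    obtain ⟨a, s, hs, rfl⟩ := (mem_ofField_iff hS x).1 hx
    refine (mem_ofField_iff hS _).2 ⟨sigmaInt k a, sigmaInt k s, hσS s hs, ?_⟩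
    rw [map_mul, map_inv₀, coe_sigmaInt, coe_sigmaInt]
  -- common denominators
  have hden : ∀ T : Finset k, (∀ t ∈ T, t ∈ O') →
      ∃ s : 𝓞 k, (s : k) ≠ 0 ∧ ((s : k))⁻¹ ∈ O' ∧ ∀ t ∈ T, (s : k) * t ∈ (algebraMap (𝓞 k) k).range := by
    intro T hT
    let T' : Finset O' := T.attach.image fun t => ⟨t.1, hT t.1 t.2⟩
    obtain ⟨b, hb⟩ := IsLocalization.exist_integer_multiples_of_finset S T'
    refine ⟨b, hS0 _ b.2, hinvS _ b.2, fun t ht => ?_⟩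
    have hmem : (⟨t, hT t ht⟩ : O') ∈ T' := Finset.mem_image.2 ⟨⟨t, ht⟩, Finset.mem_attach _ _, rfl⟩
    obtain ⟨c, hc⟩ := hb _ hmem
    refine ⟨c, ?_⟩
    have h := congrArg (fun z : O' => (z : k)) hc
    simpa [Algebra.smul_def] using h
  -- integral multiples: `O'·L ⊆ S⁻¹ L`
  have hint : ∀ x ∈ Submodule.span O' (L : Set (Fin n → k)),
      ∃ s : 𝓞 k, (s : k) ≠ 0 ∧ ((s : k))⁻¹ ∈ O' ∧ (s : k) • x ∈ L := by
    intro x hx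
    suffices h : ∃ s : 𝓞 k, s ∈ S ∧ (s : k) • x ∈ L by
      obtain ⟨s, hs, hsx⟩ := h
      exact ⟨s, hS0 s hs, hinvS s hs, hsx⟩
    induction hx using Submodule.span_induction with
    | mem x hx => exact ⟨1, one_mem S, by simpa using hx⟩
    | zero => exact ⟨1, one_mem S, by simp⟩
    | add x y _ _ h1 h2 =>
        obtain ⟨s₁, hs₁, h1⟩ := h1
        obtain ⟨s₂, hs₂, h2⟩ := h2
        refine ⟨s₁ * s₂, mul_mem hs₁ hs₂, ?_⟩
        have h : (((s₁ * s₂ : 𝓞 k)) : k) • (x + y) = s₂ • ((s₁ : k) • x) + s₁ • ((s₂ : k) • y) := by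
          rw [smul_add, show (s₂ • ((s₁ : k) • x) : Fin n → k) = (s₂ : k) • ((s₁ : k) • x) from rfl,
            show (s₁ • ((s₂ : k) • y) : Fin n → k) = (s₁ : k) • ((s₂ : k) • y) from rfl, smul_smul, smul_smul]
          push_cast
          rw [mul_comm (s₂ : k)]
        rw [h]
        exact add_mem (L.smul_mem _ h1) (L.smul_mem _ h2)
    | smul r x _ h =>
        obtain ⟨s, hs, h⟩ := h
        obtain ⟨a, s', hs', hr⟩ := (mem_ofField_iff hS (r : k)).1 r.2
        refine ⟨s' * s, mul_mem hs' hs, ?_⟩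
        have h' : (((s' * s : 𝓞 k)) : k) • (r • x) = a • ((s : k) • x) := by
          rw [Subalgebra.smul_def, hr, show (a • ((s : k) • x) : Fin n → k) = (a : k) • ((s : k) • x) from rfl, smul_smul,
            smul_smul]
          push_cast
          congr 1
          have hs'0 : ((s' : 𝓞 k) : k) ≠ 0 := hS0 s' hs'
          field_simp
        rw [h']
        exact L.smul_mem _ h
  -- the unimodular basis inside `L`
  have hJ0 : J.det ≠ 0 := SemilocalBasis.det_ne_zero_of_isSelfDualFor hL hLd
  obtain ⟨e, heL, hli, hcoord, C, hCmem, hGC⟩ := exists_basis_unimodular_gram O' hσ hden hint hL hLd hJ0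
  have hLL : ∀ x ∈ L, ∀ y ∈ L, krForm (conj ℚ k : k →+* k) J x y ∈ (algebraMap (𝓞 k) k).range :=
    fun x hx y hy => (hLd x).1 hx y hy
  choose Gf hGf using fun i j => hLL (e j) (heL j) (e i) (heL i)
  set G : Matrix (Fin n) (Fin n) (𝓞 k) := Matrix.of fun i j => Gf i j with hGdef
  have hGmap : G.map (algebraMap (𝓞 k) k) = Matrix.of fun i j => krForm (conj ℚ k : k →+* k) J (e j) (e i) := by
    ext i j
    rw [Matrix.map_apply, hGdef, Matrix.of_apply, Matrix.of_apply, hGf]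
  -- a unit `s ∈ S` has `t s ≡ 1 (mod 𝔫)`
  have hunit : ∀ s : 𝓞 k, ((s : k))⁻¹ ∈ O' → (s : k) ≠ 0 → ∃ t : 𝓞 k, s * t - 1 ∈ 𝔫 := by
    intro s hs hs0
    obtain ⟨a, s', hs', h⟩ := (mem_ofField_iff hS _).1 hs
    have hsa : s' = a * s := by
      apply RingOfIntegers.ext
      have h1 : ((s : k))⁻¹ * (s : k) = (a : k) * ((s' : k))⁻¹ * (s : k) := by rw [h]
      rw [inv_mul_cancel₀ hs0] at h1
      have h2 := congrArg (fun z => (s' : k) * z) h1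
      simp only [mul_one] at h2
      rw [h2]
      push_cast
      field_simp [hS0 s' hs']
    obtain ⟨t, ht⟩ := (hmemS s').1 hs'
    refine ⟨a * t, ?_⟩
    rw [hsa] at ht
    have : s * (a * t) - 1 = a * s * t - 1 := by ring
    rwa [this]
  refine ⟨e, G, heL, hli, ?_, ?_, fun i j => by rw [hGdef, Matrix.of_apply]; exact hGf i j, ?_⟩
  · -- (a) `Σ O_k e_i + 𝔫 L = L`
    refine le_antisymm (sup_le (Submodule.span_le.2 (by rintro _ ⟨i, rfl⟩; exact heL i)) (Submodule.smul_le_right)) ?_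
    intro x hx
    obtain ⟨c, hcO, hxc⟩ := hcoord x hx
    obtain ⟨s, hs0, hsO, hs⟩ := hden (Finset.univ.image c) (by
      intro t ht; obtain ⟨i, _, rfl⟩ := Finset.mem_image.1 ht; exact hcO i)
    choose d hd using fun i => hs (c i) (Finset.mem_image_of_mem _ (Finset.mem_univ i))
    obtain ⟨t, ht⟩ := hunit s hsO hs0
    -- `x = (s t) x - (s t - 1) x`
    have hx1 : ((s * t : 𝓞 k)) • x ∈ Submodule.span (𝓞 k) (Set.range e) := by
      rw [hxc, Finset.smul_sum]
      refine Submodule.sum_mem _ fun i _ => ?_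
      have h : ((s * t : 𝓞 k)) • (c i • e i) = (t * d i) • e i := by
        change (((s * t : 𝓞 k)) : k) • (c i • e i) = (((t * d i : 𝓞 k)) : k) • e i
        rw [smul_smul]
        congr 1
        simp only [RingOfIntegers.coe_eq_algebraMap, map_mul, hd i]
        ring
      rw [h]
      exact Submodule.smul_mem _ _ (Submodule.subset_span ⟨i, rfl⟩)
    have hx2 : ((s * t - 1 : 𝓞 k)) • x ∈ 𝔫 • L := Submodule.smul_mem_smul ht hx
    have hx3 : x = ((s * t : 𝓞 k)) • x - ((s * t - 1 : 𝓞 k)) • x := by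
      rw [sub_smul, one_smul]; abel
    rw [hx3]
    exact Submodule.sub_mem _ (Submodule.mem_sup_left hx1) (Submodule.mem_sup_right hx2)
  · -- (b) independence modulo `𝔫`: the `O'`-coordinates of `𝔫 L` lie in `𝔫 O'`, and `𝔫 O' ∩ O_k = 𝔫`
    intro a ha
    have hP : ∀ y ∈ 𝔫 • L, ∃ c : Fin n → k, y = ∑ i, c i • e i ∧
        ∀ i, ∃ m s : 𝓞 k, m ∈ 𝔫 ∧ s ∈ S ∧ c i = (m : k) * ((s : k))⁻¹ := by
      intro y hy
      refine Submodule.smul_induction_on hy ?_ ?_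
      · intro r hr y hy
        obtain ⟨c, hcO, hyc⟩ := hcoord y hy
        refine ⟨fun i => (r : k) * c i, ?_, fun i => ?_⟩
        · rw [hyc, show (r • ∑ i, c i • e i : Fin n → k) = (r : k) • ∑ i, c i • e i from rfl, Finset.smul_sum]
          exact Finset.sum_congr rfl fun i _ => by rw [smul_smul]
        · obtain ⟨a', s, hs, h⟩ := (mem_ofField_iff hS (c i)).1 (hcO i)
          exact ⟨r * a', s, Ideal.mul_mem_right _ _ hr, hs, by change (r : k) * c i = _; rw [h]; push_cast; ring⟩
      · intro y z hy hz
        obtain ⟨c, hyc, hc⟩ := hy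
        obtain ⟨c', hzc, hc'⟩ := hz
        refine ⟨c + c', ?_, fun i => ?_⟩
        · rw [hyc, hzc, ← Finset.sum_add_distrib]
          exact Finset.sum_congr rfl fun i _ => by rw [Pi.add_apply, add_smul]
        · obtain ⟨m, s, hm, hs, h⟩ := hc i
          obtain ⟨m', s', hm', hs', h'⟩ := hc' i
          refine ⟨m * s' + m' * s, s * s', 𝔫.add_mem (Ideal.mul_mem_right _ _ hm) (Ideal.mul_mem_right _ _ hm'),
            mul_mem hs hs', ?_⟩
          have hs0' : ((s : 𝓞 k) : k) ≠ 0 := hS0 s hs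
          have hs'0 : ((s' : 𝓞 k) : k) ≠ 0 := hS0 s' hs'
          rw [Pi.add_apply, h, h']
          push_cast
          field_simp
    obtain ⟨c, hc, hcm⟩ := hP _ ha
    have hca : ∀ i, c i = (a i : k) := by
      have h0 : ∑ i, (c i - (a i : k)) • e i = 0 := by
        simp only [sub_smul, Finset.sum_sub_distrib]
        rw [← hc, sub_self]
      intro i
      exact sub_eq_zero.1 (Fintype.linearIndependent_iff.1 hli _ h0 i)
    intro i
    obtain ⟨m, s, hm, hs, h⟩ := hcm i
    rw [hca i] at h
    have hsa0 : ((a i : 𝓞 k) : k) * (s : k) = (m : k) := by rw [h, inv_mul_cancel_right₀ (hS0 s hs)]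
    have hsa : a i * s = m := by exact_mod_cast hsa0
    obtain ⟨t, ht⟩ := (hmemS s).1 hs
    have h1 : a i = m * t - a i * (s * t - 1) := by rw [← hsa]; ring
    rw [h1]
    exact 𝔫.sub_mem (Ideal.mul_mem_right _ _ hm) (Ideal.mul_mem_left _ _ ht)
  · -- (c) `det G` is a unit modulo `𝔫`: `det G · det C = 1` with `det C ∈ O'`
    have hdetC : C.det ∈ O' := by
      let C' : Matrix (Fin n) (Fin n) O' := Matrix.of fun i j => ⟨C i j, hCmem i j⟩
      have hC' : C = C'.map (algebraMap O' k) := by ext i j; rfl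
      rw [hC', ← RingHom.mapMatrix_apply, ← RingHom.map_det]
      exact (C'.det).2
    have hdet1 : (G.det : k) * C.det = 1 := by
      have h := congrArg Matrix.det hGC
      rw [Matrix.det_mul, Matrix.det_one, ← hGmap, ← RingHom.mapMatrix_apply, ← RingHom.map_det] at h
      exact h
    obtain ⟨a, s, hs, h⟩ := (mem_ofField_iff hS _).1 hdetC
    have hGa : G.det * a = s := by
      apply RingOfIntegers.ext
      push_cast
      have h1 : (G.det : k) * ((a : k) * ((s : k))⁻¹) * (s : k) = (s : k) := by rw [← h, hdet1, one_mul]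
      rwa [← mul_assoc, inv_mul_cancel_right₀ (hS0 s hs)] at h1
    have hsu : IsUnit (Ideal.Quotient.mk 𝔫 s) := by
      have h := hs
      rw [hSdef, Submonoid.mem_comap, IsUnit.mem_submonoid_iff] at h
      exact h
    rw [← hGa, map_mul] at hsu
    exact isUnit_of_mul_isUnit_left hsu

end Literature.AlgebraicGeometry.ShimuraVarieties.KudlaRapoport2013.Sec13LevelStructures

end
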